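import Mathlib
import Summits.NavierStokesRegularity.FluidComputer.AbcFlowSphTailLadder
import Literature.Analysis.FunctionSpaces.TorusFluidGlueProofs
import HarnessLib

/-!
# The `g_κ₀` TAIL SENTENCE of THEOREM 3-L assembled at function level: `⟨W²w, (A₀ − ω)w⟩ ≤ −η_t‖Ww‖²`, `W = κ₀² − Δ/4π²` (cap2 g2, cell `ns-blowup`, 2026-08-26)

HONEST FRAMING (human ruling D-0035): nothing here is a claim about Navier–Stokes blow-up.
WHAT THIS IS NOT: not NS evidence. MODEL/linear bookkeeping. `AbcFlowSphTailLadder.abc_sph_weighted_tail_form_le`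
(p452123) states the weighted tail inequality as a combination `q₂ + 2κ₀²q₁ + κ₀⁴q₀` of three
separately integrated level forms against `‖Δw‖²/16π⁴ + 2κ₀²‖∇w‖²/4π² + κ₀⁴‖w‖²`. What the certificates'
TAIL hypothesis literally says (D2-CHAIN-MAP § Identification; `ShellBlockLyapunovCertificate.
generator_form_le_of_certificate`, TAIL piece, `y = Wv` coordinates) is the single sentence
`Re⟨y_t, (A^w − ω)y_t⟩ = ⟨W²v, (A − ω)v⟩ ≤ −η_t‖Wv‖²` with the booking weight `W = κ₀² − Δ` on
`(ℝ/2πℤ)³`, i.e. `W = κ₀² − Δ/4π²` on the unit torus. This file performs the two integrations by parts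
that identify the two (`⟨Δ²w, w⟩ = ‖Δw‖²`, `⟨Δw, w⟩ = −‖∇w‖²`, Green's identities
`Torus.integral_inner_laplacian_comm` / `integral_inner_laplacian_self_eq_neg_gradNormSq_of_isSmooth`)
and states the sentence with the model operator WITHOUT the Leray projector,
`A₀w = (ν/4π²)Δw − (1/2π)[(U·∇)w + (w·∇)U]`, `U = Torus.abcFlow 1 1 1` (the projector drops against
the divergence-free test fields `W²w` by `LerayProjectionDivFreePairing`, p444379, exactly as in cap's
cube chain):

* `inner_weightSq_generator_pointwise` — the pointwise expansion of `⟪κ⁴w − 2κ²cΔw + c²Δ²w, (A₀ − ω)w⟫`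
  (`c = 1/4π²`) into the three level integrands;
* `integral_norm_weight_sq_eq` — `∫‖κ²w − cΔw‖² = κ⁴‖w‖² + 2κ²c‖∇w‖² + c²‖Δw‖²`;
* `integral_inner_weightSq_generator_eq` — `∫⟪W²w, (A₀ − ω)w⟫ = c²·F₂ + 2κ²·(c·F₁) + κ⁴·F₀` with
  `F₂, F₁, F₀` the three level forms of `AbcFlowSphTailForms`;
* `abc_sph_weighted_tail_sentence` — for every smooth `w` with `𝓕w(k) = 0` on `|k|² < (K+1)²`,
  `ν ≥ 0`, `κ₀² ≥ 0`: `∫⟪W²w, (A₀ − ω)w⟫ ≤ −min(η₂, min(η₁', η₀))·∫‖Ww‖²`;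
* `abc_sph_weighted_tail_sentence_at_40` / `_at_52` — the cells of record: `≤ −0.70609·∫‖Ww‖²`
  (R 300: `ν = 1/300`, `ω = 2/5`, tail `|k| ≥ 40`) and `≤ −0.85532·∫‖Ww‖²` (R 500: `1/500`, `11/25`, `52`),
  every `κ₀² ≥ 0` (cells: `κ₀ = 17`, `22`).

Mathlib + `AbcFlowSphTailLadder` + the torus Green identities; no new definitions.
-/

noncomputable section

namespace Summit.NavierStokesRegularity.FluidComputer.AbcFlowWeightedTailSentence

open Literature.Analysis.FluidPDE Literature.Analysis.FunctionSpaces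
open Literature.Analysis.FunctionSpaces.Torus MeasureTheory UnitAddTorus
open Summit.NavierStokesRegularity.FluidComputer.AbcFlowSphTailForms
open Summit.NavierStokesRegularity.FluidComputer.AbcFlowSphTailLadder
open scoped RealInnerProductSpace

variable {w : UnitAddTorus (Fin 3) → EuclideanSpace ℝ (Fin 3)}

/-- Pointwise expansion of the weighted pairing: with `c = 1/4π²`, `C = (U·∇)w + (w·∇)U`,
`⟪κ⁴w − 2κ²c·Δw + c²·ΔΔw, νc·Δw − (1/2π)C − ω w⟫ = κ⁴(νc⟪Δw,w⟫ − (1/2π)⟪C,w⟫ − ω‖w‖²)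
 + 2κ²c(−νc‖Δw‖² + (1/2π)⟪C,Δw⟫ + ω⟪Δw,w⟫) + c²(νc⟪ΔΔw,Δw⟫ − (1/2π)⟪C,ΔΔw⟫ − ω⟪ΔΔw,w⟫)`. -/
theorem inner_weightSq_generator_pointwise (a l ll C : EuclideanSpace ℝ (Fin 3)) (κsq c ν p ω : ℝ) :
    ⟪κsq ^ 2 • a - (2 * κsq * c) • l + c ^ 2 • ll, (ν * c) • l - p • C - ω • a⟫
      = κsq ^ 2 * (ν * c * ⟪l, a⟫ - p * ⟪C, a⟫ - ω * ‖a‖ ^ 2)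
        + 2 * κsq * (c * (-(ν * c * ‖l‖ ^ 2) + p * ⟪C, l⟫ + ω * ⟪l, a⟫))
        + c ^ 2 * (ν * c * ⟪ll, l⟫ - p * ⟪C, ll⟫ - ω * ⟪ll, a⟫) := by
  simp only [inner_add_left, inner_sub_left, inner_sub_right, inner_smul_left, inner_smul_right,
    real_inner_self_eq_norm_sq, RCLike.conj_to_real]
  have h1 : ⟪a, l⟫ = ⟪l, a⟫ := real_inner_comm _ _
  have h2 : ⟪a, C⟫ = ⟪C, a⟫ := real_inner_comm _ _
  have h3 : ⟪l, C⟫ = ⟪C, l⟫ := real_inner_comm _ _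
  have h4 : ⟪ll, C⟫ = ⟪C, ll⟫ := real_inner_comm _ _
  have h5 : ⟪a, ll⟫ = ⟪ll, a⟫ := real_inner_comm _ _
  have h6 : ⟪l, ll⟫ = ⟪ll, l⟫ := real_inner_comm _ _
  rw [h1, h2, h3, h4]
  ring

/-- **The `y`-energy of a field:** `∫‖κ²w − cΔw‖² = κ⁴∫‖w‖² + 2κ²c·‖∇w‖₂² + c²∫‖Δw‖²` for smooth `w`,
`c ≥ 0` arbitrary (Green: `∫⟪Δw, w⟫ = −‖∇w‖₂²`). -/
theorem integral_norm_weight_sq_eq (hw : IsSmooth w) (κsq c : ℝ) :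
    ∫ x, ‖κsq • w x - c • laplacian w x‖ ^ 2
      = κsq ^ 2 * (∫ x, ‖w x‖ ^ 2) + 2 * κsq * (c * gradNormSq w) + c ^ 2 * (∫ x, ‖laplacian w x‖ ^ 2) := by
  have hpt : ∀ x, ‖κsq • w x - c • laplacian w x‖ ^ 2
      = κsq ^ 2 * ‖w x‖ ^ 2 - 2 * κsq * c * ⟪laplacian w x, w x⟫ + c ^ 2 * ‖laplacian w x‖ ^ 2 := by
    intro x
    rw [← real_inner_self_eq_norm_sq]
    simp only [inner_sub_left, inner_sub_right, inner_smul_left, inner_smul_right,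
      real_inner_self_eq_norm_sq, RCLike.conj_to_real]
    have h1 : ⟪w x, laplacian w x⟫ = ⟪laplacian w x, w x⟫ := real_inner_comm _ _
    rw [h1]; ring
  simp_rw [hpt]
  have i1 : Integrable (fun x => κsq ^ 2 * ‖w x‖ ^ 2) volume := hw.norm_sq.integrable.const_mul _
  have i2 : Integrable (fun x => 2 * κsq * c * ⟪laplacian w x, w x⟫) volume :=
    (hw.laplacian.inner hw).integrable.const_mul _
  have i3 : Integrable (fun x => c ^ 2 * ‖laplacian w x‖ ^ 2) volume :=
    hw.laplacian.norm_sq.integrable.const_mul _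
  have i12 : Integrable (fun x => κsq ^ 2 * ‖w x‖ ^ 2 - 2 * κsq * c * ⟪laplacian w x, w x⟫) volume :=
    i1.sub i2
  rw [integral_add i12 i3, integral_sub i1 i2, integral_const_mul, integral_const_mul,
    integral_const_mul, integral_inner_laplacian_self_eq_neg_gradNormSq_of_isSmooth hw]
  ring

/-- **The weighted pairing as the combination of the three level forms.** With `c = 1/4π²`,
`C = (U·∇)w + (w·∇)U` (`U = abc(1,1,1)`):
`∫⟪κ⁴w − 2κ²cΔw + c²ΔΔw, νcΔw − (1/2π)C − ωw⟫ = c²·F₂ + 2κ²·(c·F₁) + κ⁴·F₀`, where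
`F₂ = νc∫⟪ΔΔw,Δw⟫ − (1/2π)∫⟪C,ΔΔw⟫ − ω∫‖Δw‖²`, `F₁ = −νc∫‖Δw‖² + (1/2π)∫⟪C,Δw⟫ − ω‖∇w‖₂²`,
`F₀ = νc∫⟪Δw,w⟫ − (1/2π)∫⟪C,w⟫ − ω∫‖w‖²` (Green twice: `∫⟪ΔΔw, w⟫ = ∫‖Δw‖²`, `∫⟪Δw,w⟫ = −‖∇w‖₂²`). -/
theorem integral_inner_weightSq_generator_eq (hw : IsSmooth w) (κsq ν ω : ℝ) :
    ∫ x, ⟪κsq ^ 2 • w x - (2 * κsq * (1 / (4 * Real.pi ^ 2))) • laplacian w x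
          + (1 / (4 * Real.pi ^ 2)) ^ 2 • laplacian (laplacian w) x,
        (ν * (1 / (4 * Real.pi ^ 2))) • laplacian w x
          - (1 / (2 * Real.pi)) • (convect (Torus.abcFlow 1 1 1) w x + convect w (Torus.abcFlow 1 1 1) x)
          - ω • w x⟫
      = (1 / (4 * Real.pi ^ 2)) ^ 2 *
          (ν * (1 / (4 * Real.pi ^ 2)) * (∫ x, ⟪laplacian (laplacian w) x, laplacian w x⟫)
            - 1 / (2 * Real.pi) * (∫ x, ⟪convect (Torus.abcFlow 1 1 1) w x + convect w (Torus.abcFlow 1 1 1) x,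
                laplacian (laplacian w) x⟫)
            - ω * (∫ x, ‖laplacian w x‖ ^ 2))
        + 2 * κsq * ((1 / (4 * Real.pi ^ 2)) *
          (-(ν * (1 / (4 * Real.pi ^ 2)) * ∫ x, ‖laplacian w x‖ ^ 2)
            + 1 / (2 * Real.pi) * (∫ x, ⟪convect (Torus.abcFlow 1 1 1) w x + convect w (Torus.abcFlow 1 1 1) x,
                laplacian w x⟫)
            - ω * gradNormSq w))
        + κsq ^ 2 *
          (ν * (1 / (4 * Real.pi ^ 2)) * (∫ x, ⟪laplacian w x, w x⟫)
            - 1 / (2 * Real.pi) * (∫ x, ⟪convect (Torus.abcFlow 1 1 1) w x + convect w (Torus.abcFlow 1 1 1) x, w x⟫)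
            - ω * (∫ x, ‖w x‖ ^ 2)) := by
  set U := Torus.abcFlow (1:ℝ) 1 1 with hU
  set c : ℝ := 1 / (4 * Real.pi ^ 2) with hc
  set p : ℝ := 1 / (2 * Real.pi) with hp
  have hUs : IsSmooth U := Torus.isSmooth_abcFlow 1 1 1
  have hC : IsSmooth (fun x => convect U w x + convect w U x) := (hUs.convect hw).add (hw.convect hUs)
  have hl : IsSmooth (laplacian w) := hw.laplacian
  have hll : IsSmooth (laplacian (laplacian w)) := hw.laplacian.laplacian
  simp_rw [inner_weightSq_generator_pointwise]
  -- integrability of the three bracketed integrands and of their atoms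
  have a1 : Integrable (fun x => ⟪laplacian w x, w x⟫) volume := (hl.inner hw).integrable
  have a2 : Integrable (fun x => ⟪convect U w x + convect w U x, w x⟫) volume := (hC.inner hw).integrable
  have a3 : Integrable (fun x => ‖w x‖ ^ 2) volume := hw.norm_sq.integrable
  have b1 : Integrable (fun x => ‖laplacian w x‖ ^ 2) volume := hl.norm_sq.integrable
  have b2 : Integrable (fun x => ⟪convect U w x + convect w U x, laplacian w x⟫) volume :=
    (hC.inner hl).integrable
  have c1 : Integrable (fun x => ⟪laplacian (laplacian w) x, laplacian w x⟫) volume := (hll.inner hl).integrable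
  have c2 : Integrable (fun x => ⟪convect U w x + convect w U x, laplacian (laplacian w) x⟫) volume :=
    (hC.inner hll).integrable
  have c3 : Integrable (fun x => ⟪laplacian (laplacian w) x, w x⟫) volume := (hll.inner hw).integrable
  have g0 : Integrable (fun x => ν * c * ⟪laplacian w x, w x⟫ - p * ⟪convect U w x + convect w U x, w x⟫
      - ω * ‖w x‖ ^ 2) volume := ((a1.const_mul _).sub (a2.const_mul _)).sub (a3.const_mul _)
  have g1 : Integrable (fun x => c * (-(ν * c * ‖laplacian w x‖ ^ 2)
      + p * ⟪convect U w x + convect w U x, laplacian w x⟫ + ω * ⟪laplacian w x, w x⟫)) volume :=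
    (((b1.const_mul _).neg.add (b2.const_mul _)).add (a1.const_mul _)).const_mul _
  have g2 : Integrable (fun x => ν * c * ⟪laplacian (laplacian w) x, laplacian w x⟫
      - p * ⟪convect U w x + convect w U x, laplacian (laplacian w) x⟫
      - ω * ⟪laplacian (laplacian w) x, w x⟫) volume :=
    ((c1.const_mul _).sub (c2.const_mul _)).sub (c3.const_mul _)
  have g0' : Integrable (fun x => κsq ^ 2 * (ν * c * ⟪laplacian w x, w x⟫
      - p * ⟪convect U w x + convect w U x, w x⟫ - ω * ‖w x‖ ^ 2)) volume := g0.const_mul _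
  have g1' : Integrable (fun x => 2 * κsq * (c * (-(ν * c * ‖laplacian w x‖ ^ 2)
      + p * ⟪convect U w x + convect w U x, laplacian w x⟫ + ω * ⟪laplacian w x, w x⟫))) volume :=
    g1.const_mul _
  have g2' : Integrable (fun x => c ^ 2 * (ν * c * ⟪laplacian (laplacian w) x, laplacian w x⟫
      - p * ⟪convect U w x + convect w U x, laplacian (laplacian w) x⟫
      - ω * ⟪laplacian (laplacian w) x, w x⟫)) volume := g2.const_mul _
  have g01 : Integrable (fun x => κsq ^ 2 * (ν * c * ⟪laplacian w x, w x⟫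
      - p * ⟪convect U w x + convect w U x, w x⟫ - ω * ‖w x‖ ^ 2)
      + 2 * κsq * (c * (-(ν * c * ‖laplacian w x‖ ^ 2)
      + p * ⟪convect U w x + convect w U x, laplacian w x⟫ + ω * ⟪laplacian w x, w x⟫))) volume :=
    g0'.add g1'
  rw [integral_add g01 g2', integral_add g0' g1']
  simp only [integral_const_mul]
  -- evaluate the three bracket integrals
  have e0 : ∫ x, (ν * c * ⟪laplacian w x, w x⟫ - p * ⟪convect U w x + convect w U x, w x⟫ - ω * ‖w x‖ ^ 2)
      = ν * c * (∫ x, ⟪laplacian w x, w x⟫) - p * (∫ x, ⟪convect U w x + convect w U x, w x⟫)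
        - ω * (∫ x, ‖w x‖ ^ 2) := by
    have t1 : Integrable (fun x => ν * c * ⟪laplacian w x, w x⟫
        - p * ⟪convect U w x + convect w U x, w x⟫) volume := (a1.const_mul _).sub (a2.const_mul _)
    rw [integral_sub t1 (a3.const_mul _), integral_sub (a1.const_mul _) (a2.const_mul _)]
    simp only [integral_const_mul]
  have e1 : ∫ x, (-(ν * c * ‖laplacian w x‖ ^ 2) + p * ⟪convect U w x + convect w U x, laplacian w x⟫
        + ω * ⟪laplacian w x, w x⟫)
      = -(ν * c * ∫ x, ‖laplacian w x‖ ^ 2) + p * (∫ x, ⟪convect U w x + convect w U x, laplacian w x⟫)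
        - ω * gradNormSq w := by
    have t0 : Integrable (fun x => -(ν * c * ‖laplacian w x‖ ^ 2)) volume := (b1.const_mul _).neg
    have t1 : Integrable (fun x => -(ν * c * ‖laplacian w x‖ ^ 2)
        + p * ⟪convect U w x + convect w U x, laplacian w x⟫) volume := t0.add (b2.const_mul _)
    rw [integral_add t1 (a1.const_mul _), integral_add t0 (b2.const_mul _), integral_neg]
    simp only [integral_const_mul]
    rw [integral_inner_laplacian_self_eq_neg_gradNormSq_of_isSmooth hw]
    ring
  have hG2 : ∫ x, ⟪laplacian (laplacian w) x, w x⟫ = ∫ x, ‖laplacian w x‖ ^ 2 := by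
    rw [Torus.integral_inner_laplacian_comm hl hw]
    exact integral_congr_ae (ae_of_all _ fun x => real_inner_self_eq_norm_sq _)
  have e2 : ∫ x, (ν * c * ⟪laplacian (laplacian w) x, laplacian w x⟫
        - p * ⟪convect U w x + convect w U x, laplacian (laplacian w) x⟫ - ω * ⟪laplacian (laplacian w) x, w x⟫)
      = ν * c * (∫ x, ⟪laplacian (laplacian w) x, laplacian w x⟫)
        - p * (∫ x, ⟪convect U w x + convect w U x, laplacian (laplacian w) x⟫)
        - ω * (∫ x, ‖laplacian w x‖ ^ 2) := by
    have t1 : Integrable (fun x => ν * c * ⟪laplacian (laplacian w) x, laplacian w x⟫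
        - p * ⟪convect U w x + convect w U x, laplacian (laplacian w) x⟫) volume :=
      (c1.const_mul _).sub (c2.const_mul _)
    rw [integral_sub t1 (c3.const_mul _), integral_sub (c1.const_mul _) (c2.const_mul _)]
    simp only [integral_const_mul]
    rw [hG2]
  rw [e0, e1, e2]
  ring

/-- **The TAIL SENTENCE of THEOREM 3-L in `y = (κ₀² − Δ/4π²)v` coordinates, spherical tail `|k| ≥ K+1`.**
For `U = abc(1,1,1)` on the unit torus, `ν ≥ 0`, `ω ∈ ℝ`, `κsq = κ₀² ≥ 0`, `c = 1/4π²`, and every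
smooth `w` whose Fourier coefficients vanish on `|k|² < (K+1)²`:
`∫⟪κ₀⁴w − 2κ₀²cΔw + c²ΔΔw, νcΔw − (1/2π)[(U·∇)w + (w·∇)U] − ωw⟫ ≤ −η_t·∫‖κ₀²w − cΔw‖²` with
`η_t = min(η₂, min(η₁', η₀))` — literally `⟨W²w, (A₀ − ω)w⟩ ≤ −η_t‖Ww‖²`, `W = κ₀² − cΔ`. -/
theorem abc_sph_weighted_tail_sentence (hw : IsSmooth w) {K : ℕ}
    (hsph : ∀ k : Fin 3 → ℤ, freqNormSq k < ((K : ℝ) + 1) ^ 2 →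
      mFourierCoeff (EuclideanSpace.complexify ∘ w) k = 0)
    {ν ω κsq : ℝ} (hν : 0 ≤ ν) (hκ : 0 ≤ κsq) :
    ∫ x, ⟪κsq ^ 2 • w x - (2 * κsq * (1 / (4 * Real.pi ^ 2))) • laplacian w x
          + (1 / (4 * Real.pi ^ 2)) ^ 2 • laplacian (laplacian w) x,
        (ν * (1 / (4 * Real.pi ^ 2))) • laplacian w x
          - (1 / (2 * Real.pi)) • (convect (Torus.abcFlow 1 1 1) w x + convect w (Torus.abcFlow 1 1 1) x)
          - ω • w x⟫
      ≤ -(min (ν * ((K : ℝ) + 1) ^ 2 + ω - (2 * Real.sqrt 3 + Real.sqrt 2)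
              - (Real.sqrt 6 + 2 * Real.sqrt 3) / ((K : ℝ) + 1) - Real.sqrt 3 / ((K : ℝ) + 1) ^ 2)
            (min (ν * ((K : ℝ) + 1) ^ 2 + ω - (Real.sqrt 3 + Real.sqrt 2) - Real.sqrt 3 / ((K : ℝ) + 1))
              (ν * ((K : ℝ) + 1) ^ 2 + ω - Real.sqrt 2))) *
        ∫ x, ‖κsq • w x - (1 / (4 * Real.pi ^ 2)) • laplacian w x‖ ^ 2 := by
  have h := abc_sph_weighted_tail_form_le hw hsph (ν := ν) (ω := ω) hν hκ
  rw [integral_inner_weightSq_generator_eq hw κsq ν ω, integral_norm_weight_sq_eq hw κsq (1 / (4 * Real.pi ^ 2))]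
  have e1 : (1 / (4 * Real.pi ^ 2)) ^ 2 = 1 / (16 * Real.pi ^ 4) := by ring
  have e2 : ν / (4 * Real.pi ^ 2) = ν * (1 / (4 * Real.pi ^ 2)) := by ring
  rw [e1]
  rw [e2] at h
  convert h using 2
  ring

/-- **R 300 cells of record (`ν = 1/300`, `ω = 2/5`, tail `|k| ≥ 40`, `κ₀ = 17` i.e. any `κsq ≥ 0`):**
`⟨W²w, (A₀ − ω)w⟩ ≤ −0.70609·‖Ww‖²`. -/
theorem abc_sph_weighted_tail_sentence_at_40 (hw : IsSmooth w)
    (hsph : ∀ k : Fin 3 → ℤ, freqNormSq k < (40 : ℝ) ^ 2 →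
      mFourierCoeff (EuclideanSpace.complexify ∘ w) k = 0)
    {κsq : ℝ} (hκ : 0 ≤ κsq) :
    ∫ x, ⟪κsq ^ 2 • w x - (2 * κsq * (1 / (4 * Real.pi ^ 2))) • laplacian w x
          + (1 / (4 * Real.pi ^ 2)) ^ 2 • laplacian (laplacian w) x,
        ((1 / 300 : ℝ) * (1 / (4 * Real.pi ^ 2))) • laplacian w x
          - (1 / (2 * Real.pi)) • (convect (Torus.abcFlow 1 1 1) w x + convect w (Torus.abcFlow 1 1 1) x)
          - (2 / 5 : ℝ) • w x⟫
      ≤ -(0.70609 : ℝ) * ∫ x, ‖κsq • w x - (1 / (4 * Real.pi ^ 2)) • laplacian w x‖ ^ 2 := by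
  have hsph' : ∀ k : Fin 3 → ℤ, freqNormSq k < (((39 : ℕ) : ℝ) + 1) ^ 2 →
      mFourierCoeff (EuclideanSpace.complexify ∘ w) k = 0 := fun k hk => hsph k (by norm_num at hk ⊢; exact hk)
  have h := abc_sph_weighted_tail_sentence hw hsph' (ν := 1 / 300) (ω := 2 / 5) (by norm_num) hκ
  have e : ((39 : ℕ) : ℝ) + 1 = 40 := by norm_num
  rw [e, eta_t_at_40_eq_eta2] at h
  have hpos : 0 ≤ ∫ x, ‖κsq • w x - (1 / (4 * Real.pi ^ 2)) • laplacian w x‖ ^ 2 :=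
    integral_nonneg fun x => sq_nonneg _
  refine h.trans (mul_le_mul_of_nonneg_right ?_ hpos)
  linarith [eta2_at_40_bounds.1]

/-- **R 500 cell of record (`ν = 1/500`, `ω = 11/25`, tail `|k| ≥ 52`, `κ₀ = 22` i.e. any `κsq ≥ 0`):**
`⟨W²w, (A₀ − ω)w⟩ ≤ −0.85532·‖Ww‖²`. -/
theorem abc_sph_weighted_tail_sentence_at_52 (hw : IsSmooth w)
    (hsph : ∀ k : Fin 3 → ℤ, freqNormSq k < (52 : ℝ) ^ 2 →
      mFourierCoeff (EuclideanSpace.complexify ∘ w) k = 0)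
    {κsq : ℝ} (hκ : 0 ≤ κsq) :
    ∫ x, ⟪κsq ^ 2 • w x - (2 * κsq * (1 / (4 * Real.pi ^ 2))) • laplacian w x
          + (1 / (4 * Real.pi ^ 2)) ^ 2 • laplacian (laplacian w) x,
        ((1 / 500 : ℝ) * (1 / (4 * Real.pi ^ 2))) • laplacian w x
          - (1 / (2 * Real.pi)) • (convect (Torus.abcFlow 1 1 1) w x + convect w (Torus.abcFlow 1 1 1) x)
          - (11 / 25 : ℝ) • w x⟫
      ≤ -(0.85532 : ℝ) * ∫ x, ‖κsq • w x - (1 / (4 * Real.pi ^ 2)) • laplacian w x‖ ^ 2 := by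
  have hsph' : ∀ k : Fin 3 → ℤ, freqNormSq k < (((51 : ℕ) : ℝ) + 1) ^ 2 →
      mFourierCoeff (EuclideanSpace.complexify ∘ w) k = 0 := fun k hk => hsph k (by norm_num at hk ⊢; exact hk)
  have h := abc_sph_weighted_tail_sentence hw hsph' (ν := 1 / 500) (ω := 11 / 25) (by norm_num) hκ
  have e : ((51 : ℕ) : ℝ) + 1 = 52 := by norm_num
  rw [e, eta_t_at_52_eq_eta2] at h
  have hpos : 0 ≤ ∫ x, ‖κsq • w x - (1 / (4 * Real.pi ^ 2)) • laplacian w x‖ ^ 2 :=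
    integral_nonneg fun x => sq_nonneg _
  refine h.trans (mul_le_mul_of_nonneg_right ?_ hpos)
  linarith [eta2_at_52_bounds.1]

end Summit.NavierStokesRegularity.FluidComputer.AbcFlowWeightedTailSentence

/-! ## Appendix (cap2 g2, same day): the R 100 cells — cap2's E-b cell (sph, `K = 24`, `κ₀ = 10`) and cap's D2 cube cells (`|k|_∞ ≤ 24`, `κ₀ = 10` / `0`) -/

namespace Summit.NavierStokesRegularity.FluidComputer.AbcFlowWeightedTailSentence

open Literature.Analysis.FluidPDE Literature.Analysis.FunctionSpaces
open Literature.Analysis.FunctionSpaces.Torus MeasureTheory UnitAddTorus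
open Summit.NavierStokesRegularity.FluidComputer.AbcFlowSphTailForms
open Summit.NavierStokesRegularity.FluidComputer.AbcFlowSphTailLadder
open scoped RealInnerProductSpace

variable {w : UnitAddTorus (Fin 3) → EuclideanSpace ℝ (Fin 3)}

/-- **R 100 cells (`ν = 1/100`, `ω = 11/50`, tail `|k| ≥ 25`; cap2's E-b cell j250045, `κ₀ = 10`):**
`⟨W²w, (A₀ − ω)w⟩ ≤ −1.352·‖Ww‖²` for every `κsq ≥ 0` (binding level `η₂(25) ∈ (1.352, 1.353)`,
`AbcKappa0TailLevels.eta2_at_25_bounds` / `eta_t_generic_at_25_eq_eta2`). -/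
theorem abc_sph_weighted_tail_sentence_at_25 (hw : IsSmooth w)
    (hsph : ∀ k : Fin 3 → ℤ, freqNormSq k < (25 : ℝ) ^ 2 →
      mFourierCoeff (EuclideanSpace.complexify ∘ w) k = 0)
    {κsq : ℝ} (hκ : 0 ≤ κsq) :
    ∫ x, ⟪κsq ^ 2 • w x - (2 * κsq * (1 / (4 * Real.pi ^ 2))) • laplacian w x
          + (1 / (4 * Real.pi ^ 2)) ^ 2 • laplacian (laplacian w) x,
        ((1 / 100 : ℝ) * (1 / (4 * Real.pi ^ 2))) • laplacian w x
          - (1 / (2 * Real.pi)) • (convect (Torus.abcFlow 1 1 1) w x + convect w (Torus.abcFlow 1 1 1) x)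
          - (11 / 50 : ℝ) • w x⟫
      ≤ -(1.352 : ℝ) * ∫ x, ‖κsq • w x - (1 / (4 * Real.pi ^ 2)) • laplacian w x‖ ^ 2 := by
  have hsph' : ∀ k : Fin 3 → ℤ, freqNormSq k < (((24 : ℕ) : ℝ) + 1) ^ 2 →
      mFourierCoeff (EuclideanSpace.complexify ∘ w) k = 0 := fun k hk => hsph k (by norm_num at hk ⊢; exact hk)
  have h := abc_sph_weighted_tail_sentence hw hsph' (ν := 1 / 100) (ω := 11 / 50) (by norm_num) hκ
  have e : ((24 : ℕ) : ℝ) + 1 = 25 := by norm_num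
  rw [e, AbcKappa0TailLevels.eta_t_generic_at_25_eq_eta2] at h
  have hpos : 0 ≤ ∫ x, ‖κsq • w x - (1 / (4 * Real.pi ^ 2)) • laplacian w x‖ ^ 2 :=
    integral_nonneg fun x => sq_nonneg _
  refine h.trans (mul_le_mul_of_nonneg_right ?_ hpos)
  linarith [AbcKappa0TailLevels.eta2_at_25_bounds.1]

/-- **cap's D2 cube cells at R 100** (`|k|_∞ ≥ 25` tail, i.e. `𝓕w = 0` on the cube `|k|_∞ ≤ 24`;
j247916 class I `κ₀ = 10`, j248925 class II `κ₀ = 10`, the `κ₀ = 0` E1 cells with `κsq = 0`): the same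
sentence, the cube hypothesis being the stronger one (`FrequencyCutoffPoincare.coeff_eq_zero_of_cube_tail`). -/
theorem abc_cube_weighted_tail_sentence_at_25 (hw : IsSmooth w)
    (hcube : ∀ k : Fin 3 → ℤ, (∀ i, |k i| ≤ (24 : ℤ)) →
      mFourierCoeff (EuclideanSpace.complexify ∘ w) k = 0)
    {κsq : ℝ} (hκ : 0 ≤ κsq) :
    ∫ x, ⟪κsq ^ 2 • w x - (2 * κsq * (1 / (4 * Real.pi ^ 2))) • laplacian w x
          + (1 / (4 * Real.pi ^ 2)) ^ 2 • laplacian (laplacian w) x,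
        ((1 / 100 : ℝ) * (1 / (4 * Real.pi ^ 2))) • laplacian w x
          - (1 / (2 * Real.pi)) • (convect (Torus.abcFlow 1 1 1) w x + convect w (Torus.abcFlow 1 1 1) x)
          - (11 / 50 : ℝ) • w x⟫
      ≤ -(1.352 : ℝ) * ∫ x, ‖κsq • w x - (1 / (4 * Real.pi ^ 2)) • laplacian w x‖ ^ 2 := by
  have hcube' : ∀ k : Fin 3 → ℤ, (∀ i, |k i| ≤ ((24 : ℕ) : ℤ)) →
      mFourierCoeff (EuclideanSpace.complexify ∘ w) k = 0 := fun k hk => hcube k (by simpa using hk)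
  have hcut := FrequencyCutoffPoincare.coeff_eq_zero_of_cube_tail (w := w) hcube'
  have e : ((24 : ℕ) : ℝ) + 1 = 25 := by norm_num
  rw [e] at hcut
  exact abc_sph_weighted_tail_sentence_at_25 hw hcut hκ

end Summit.NavierStokesRegularity.FluidComputer.AbcFlowWeightedTailSentence
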